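import Mathlib
import Summits.NavierStokesRegularity.NavierStokesRegularity.Theses.QuantisedSymmetry
import Summits.NavierStokesRegularity.NavierStokesRegularity.Theses.Blowup
import Summits.NavierStokesRegularity.NavierStokesRegularity.Theorems.QuantisedSymmetryPolyhedralTruncationBridge
import Summits.NavierStokesRegularity.NavierStokesRegularity.Theorems.QuantisedSymmetryLiouvilleKillsProfile
import Summits.NavierStokesRegularity.NavierStokesRegularity.Theorems.QuantisedSymmetryPolyhedralDssProfileExistsDominatesBlowupProfile
import Literature.Analysis.FluidPDE.AncientSimilarityVariables

/-!
# Strategist sketch s21-g4 (crux `QuantisedSymmetry.PolyhedralDssProfileExists`, stmt-NavierStokesRegularity-1404)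

Typed objects referred to by `STRATEGY-CENSUS-s21.md` (independent census family `s`, gen 4).
Nothing in this file is a registered line or a route item. Every `theorem` is sorry-free logic over
tree declarations; the `def`s are the candidate intermediates / strengthenings / split pieces the
census examines and REJECTS as leverage, with the reason recorded in the census.

Sections
* §1 the chain summit-down: `C ⇒ I2 ⇒ I1 ⇒ ¬S` with the in-tree theorems that certify each arrow;
* §2 the weaker consequence `W3 = ¬ PolyhedralTypeILiouville` (does not feed `closes`);
* §3 strengthenings `S⁺_cl` (classical polyhedral Leray breather) — typed;
* §4 the abstract Newton–Kantorovich split `B1 ∧ B2(C) → C` and the COSTUME WITNESS `C → B2(C)`,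
  showing that the certificate piece is equivalent to the crux unless the zero-finding map is pinned
  to the concrete Leray period map (then it is a strengthening: a NONDEGENERATE orbit).
-/

set_option linter.dupNamespace false

namespace Summit.NavierStokesRegularity.NavierStokesRegularity.Cruxes.PolyhedralDssProfileExists.StrategistS21g4

open MeasureTheory Set
open Literature.Analysis.FluidPDE
open Summit.NavierStokesRegularity.NavierStokesRegularity.Theses

/-! ## §1 The chain from the summit down -/

/-- **I2** (strictly between the crux and `¬S` in logical strength, NOT easier): a nontrivial Type-I
`λ`-DSS ancient mild profile exists — the crux with its three group clauses and the equivariance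
clause deleted; the antecedent of the proved sector-agnostic truncation
`filamentSkeletonRss_rdssProfileTruncation_proof` (RdssProfileTruncation, stmt-11289) and, up to the
rotated half, `Blowup.BlowupTypeIDssProfile` (stmt-0155). -/
def DssTypeIProfileExists : Prop :=
  ∃ c : ℝ, 1 < c ∧ ∃ u : ℝ → EuclideanSpace ℝ (Fin 3) → EuclideanSpace ℝ (Fin 3),
    IsAncientMildSolution 1 u ∧ (∀ t < 0, AEStronglyMeasurable (u t) volume) ∧
      IsDiscretelySelfSimilar c u ∧ (∃ C₀ : ℝ, HasTypeIDecay C₀ u) ∧ ¬ (∀ t < 0, u t =ᵐ[volume] 0)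

/-- `C ⇒ I2`: forget the symmetry. -/
theorem i2_of_crux (hX : QuantisedSymmetry.PolyhedralDssProfileExists) : DssTypeIProfileExists := by
  obtain ⟨G, -, -, -, c, hc, u, h1, h2, h3, h4, -, h6⟩ := hX
  exact ⟨c, hc, u, h1, h2, h3, h4, h6⟩

/-- `I2 ⇒ ¬ TypeIDSSLiouville λ` at the witness factor, hence `I2 ⇒ Blowup #5` (stmt-0155). -/
theorem blowupProfile_of_i2 (h : DssTypeIProfileExists) : Blowup.BlowupTypeIDssProfile := by
  obtain ⟨c, hc, u, h1, h2, h3, h4, h6⟩ := h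
  unfold Blowup.BlowupTypeIDssProfile
  intro hL
  exact h6 ((hL c).1 hc u h1 h2 h3 h4)

/-- The same arrow through the landed registered stub of line `polyhedral_cell`. -/
example : QuantisedSymmetry.PolyhedralDssProfileExists → Blowup.BlowupTypeIDssProfile :=
  Summit.NavierStokesRegularity.NavierStokesRegularity.Theorems.PolyhedralDssProfileExists.PolyhedralCell.stub_dominatesBlowupProfile

/-- **I1** = X5a of route `Blowup` (`Blowup.BlowupExists`, stmt-0152): a finite-lifespan Leray–Hopf
classical solution from a rapidly decaying datum. `C ⇒ I1` is the PROVED per-sector bridge. -/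
theorem i1_of_crux (hX : QuantisedSymmetry.PolyhedralDssProfileExists)
    (hB : QuantisedSymmetry.PolyhedralTruncationBridge) : Blowup.BlowupExists := by
  obtain ⟨G, hG1, hG2, hG3, c, hc, u, h1, h2, h3, h4, h5, h6⟩ := hX
  exact hB G hG1 hG2 hG3 c hc u h1 h2 h3 h4 h5 h6

/-- `I1 ⇒ ¬S` given Clay uniqueness (X5b, proved): the `blowup_assembly` glue. -/
theorem not_nsr_of_i1 (h1 : Blowup.BlowupExists) (hU : QuantisedSymmetry.ClayUniqueness) :
    ¬ _root_.NavierStokesRegularity :=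
  _root_.Literature.NS.blowup_assembly ⟨h1, hU⟩

/-- **The crux alone decides the summit** (both other binders of `closes` are theorems in the tree):
`C ⇒ ¬ NavierStokesRegularity`, unconditionally. This is the certified strict(?) strengthening
`C ⇒ ¬S`; no converse `¬S ⇒ C` is known or expected (a blow-up need not be Type I, DSS, or symmetric). -/
theorem crux_decides (hX : QuantisedSymmetry.PolyhedralDssProfileExists) : ¬ _root_.NavierStokesRegularity :=
  not_nsr_of_i1
    (i1_of_crux hX
      Summit.NavierStokesRegularity.NavierStokesRegularity.Theorems.quantisedSymmetry_polyhedralTruncationBridge_proof)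
    QuantisedSymmetry.ClayUniqueness_holds

/-! ## §2 The weaker consequence that does NOT feed `closes` -/

/-- **W3**: failure of the polyhedral Type-I Liouville theorem (the route's kill switch #3 negated).
Strictly weaker than the crux in the sense that `C ⇒ W3` is proved (`LiouvilleKillsProfile`) while
`W3 ⇒ C` would need a compactness/selection producing a DSS orbit from a merely bounded ancient
G-equivariant Type-I solution — nothing of the kind is known; and W3 does not feed `closes`. -/
def W3 : Prop := ¬ QuantisedSymmetry.PolyhedralTypeILiouville

theorem w3_of_crux (hX : QuantisedSymmetry.PolyhedralDssProfileExists) : W3 := fun h3 =>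
  Summit.NavierStokesRegularity.NavierStokesRegularity.Theorems.quantisedSymmetry_liouvilleKillsProfile_proof
    h3 hX

/-! ## §3 Strengthenings (typed) -/

/-- **S⁺_cl — classical polyhedral Leray breather.** A finite irreducible rotation group `G`, a
period `S > 0` and a CLASSICAL solution `(U, P)` of the backward Leray system
`∂ₛU + ½U + ½(y·∇)U + (U·∇)U + ∇P = ΔU`, `div U = 0` on all of `s ∈ ℝ`
(`IsBackwardLeraySolutionOn univ 1 U P`), `S`-periodic in `s`, with the profile Type-I bound
`(1 + |y|)|U(s,y)| ≤ C₀` (= `hasTypeIDecay_iff_lerayOrbit`), `G`-equivariant, not identically zero.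
Via `ofLerayOrbit` / `isClassicalNSSolutionOn_ofLerayOrbit_iff` and
`stub_ancientMild_of_classical_typeI` (landed) this gives the crux with `λ = e^{S/2}`; conversely a
crux witness is smooth on the open past by parabolic regularity, so S⁺_cl is the crux in classical
clothes — more rigid as an OBJECT (a smooth periodic orbit of an autonomous parabolic system), not
easier as a CLAIM. Recorded to fix the object the CAP/NK discussion of the census is about. -/
def ClassicalPolyhedralLerayBreather : Prop :=
  ∃ G : Subgroup (EuclideanSpace ℝ (Fin 3) ≃ₗᵢ[ℝ] EuclideanSpace ℝ (Fin 3)), Finite G ∧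
    (∀ g ∈ G, LinearMap.det (g.toLinearEquiv : EuclideanSpace ℝ (Fin 3) →ₗ[ℝ] EuclideanSpace ℝ (Fin 3)) = 1) ∧
    (∀ V : Submodule ℝ (EuclideanSpace ℝ (Fin 3)), (∀ g ∈ G, ∀ v ∈ V, g v ∈ V) → V = ⊥ ∨ V = ⊤) ∧
    ∃ S : ℝ, 0 < S ∧ ∃ (U : ℝ → EuclideanSpace ℝ (Fin 3) → EuclideanSpace ℝ (Fin 3))
      (P : ℝ → EuclideanSpace ℝ (Fin 3) → ℝ),
      IsBackwardLeraySolutionOn univ 1 U P ∧ (∀ s y, U (s + S) y = U s y) ∧ (∀ s y, P (s + S) y = P s y) ∧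
        (∃ C₀ : ℝ, ∀ s y, (1 + ‖y‖) * ‖U s y‖ ≤ C₀) ∧ (∀ g ∈ G, ∀ s y, U s (g y) = g (U s y)) ∧
        ¬ (∀ s y, U s y = 0)

/-! ## §4 The abstract Newton–Kantorovich split and its costume witness -/

/-- **B1 — abstract Newton–Kantorovich / radii-polynomial theorem** (TOOLS; provable from the Banach
fixed-point theorem on the closed ball, Mathlib `ContractingWith`): if `T x = x − A (F x)` is a
`Z`-Lipschitz self-map of `closedBall x̄ r` up to the defect `Y` with `Y + Z r ≤ r`, `Z < 1`, and the
preconditioner `A` is injective, then `F` has a zero in the ball. -/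
def AbstractNewtonKantorovich : Prop :=
  ∀ (X : Type) [NormedAddCommGroup X] [NormedSpace ℝ X] [CompleteSpace X]
    (F : X → X) (A : X →L[ℝ] X) (x₀ : X) (Y Z r : ℝ),
    0 ≤ Y → 0 ≤ Z → Z < 1 → 0 < r → Y + Z * r ≤ r → ‖A (F x₀)‖ ≤ Y →
      (∀ x₁ ∈ Metric.closedBall x₀ r, ∀ x₂ ∈ Metric.closedBall x₀ r,
        ‖(x₁ - A (F x₁)) - (x₂ - A (F x₂))‖ ≤ Z * ‖x₁ - x₂‖) →
      Function.Injective A → ∃ x ∈ Metric.closedBall x₀ r, F x = 0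

/-- **B2(C) — "certified formulation"**: SOME Banach space, SOME map whose zeros in the ball lift to
`C`, and a verified certificate. Typed with the formulation left free, this is where the whole crux
hides: `lifts_of_nk` gives `B1 → B2(C) → C` and `certified_of` gives `C → B2(C)` with a one-point
system — so `B2(C) ↔ C` modulo the provable `B1`. Only with `(X, F)` PINNED to the Leray period map
of §3 does `B2` acquire content, and then it asserts a NONDEGENERATE breather (invertible linearisation
at a near-solution), a strengthening of the crux that nobody can seed today (census §Transfer). -/
def CertifiedZeroLifts (C : Prop) : Prop :=
  ∃ (X : Type) (_ : NormedAddCommGroup X) (_ : NormedSpace ℝ X) (_ : CompleteSpace X)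
    (F : X → X) (A : X →L[ℝ] X) (x₀ : X) (Y Z r : ℝ),
    (∀ x ∈ Metric.closedBall x₀ r, F x = 0 → C) ∧
      0 ≤ Y ∧ 0 ≤ Z ∧ Z < 1 ∧ 0 < r ∧ Y + Z * r ≤ r ∧ ‖A (F x₀)‖ ≤ Y ∧
      (∀ x₁ ∈ Metric.closedBall x₀ r, ∀ x₂ ∈ Metric.closedBall x₀ r,
        ‖(x₁ - A (F x₁)) - (x₂ - A (F x₂))‖ ≤ Z * ‖x₁ - x₂‖) ∧
      Function.Injective A

/-- The split assembles: `B1 → B2(C) → C`. -/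
theorem lifts_of_nk {C : Prop} (hNK : AbstractNewtonKantorovich) (h : CertifiedZeroLifts C) : C := by
  obtain ⟨X, i1, i2, i3, F, A, x₀, Y, Z, r, hlift, hY, hZ, hZ1, hr, hsum, hres, hcontr, hinj⟩ := h
  obtain ⟨x, hx, hFx⟩ := hNK X F A x₀ Y Z r hY hZ hZ1 hr hsum hres hcontr hinj
  exact hlift x hx hFx

/-- **Costume witness**: `C → B2(C)` with the one-point system `X = ℝ`, `F = id`, `A = id`,
`x₀ = 0`, `Y = Z = 0`, `r = 1`. Hence the abstract certificate piece is not weaker than the crux. -/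
theorem certified_of {C : Prop} (h : C) : CertifiedZeroLifts C := by
  refine ⟨ℝ, inferInstance, inferInstance, inferInstance, id, ContinuousLinearMap.id ℝ ℝ, 0, 0, 0, 1,
    fun _ _ _ => h, le_rfl, le_rfl, zero_lt_one, zero_lt_one, by norm_num, by simp, ?_, ?_⟩
  · intro x₁ _ x₂ _
    simp
  · exact fun a b hab => by simpa using hab

/-- So, modulo tools, the abstract split is an equivalence: `(B1 → (B2(C) ↔ C))`. -/
theorem certifiedZeroLifts_iff {C : Prop} (hNK : AbstractNewtonKantorovich) : CertifiedZeroLifts C ↔ C :=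
  ⟨lifts_of_nk hNK, certified_of⟩

end Summit.NavierStokesRegularity.NavierStokesRegularity.Cruxes.PolyhedralDssProfileExists.StrategistS21g4
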